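import Summits.CriticalPhenomena.SAWScalingLimit.Theorems.SimpleSubseqLimits.Negative.SimpleSubseqLimitsHonesty
import Summits.CriticalPhenomena.SAWScalingLimit.Theorems.SimpleSubseqLimits.Negative.SimpleSubseqLimitsNecessary
import Literature.Probability.RandomPlanarGeometry.SimpleCurves
import Literature.Probability.Percolation.QuadCrossingContinuityEventsProofs

/-!
# drefute stmt-CriticalPhenomena-4982 / line `marked-point-revisit` — the lead's RESHAPED stubs 4 and 5
(skeleton sha 909bc12e…, cycle 1): stub 4 `stub_noMarkedRevisit` PROVED with its exact registered
signature; stub 5's target `NoTouchAt` certified NOT over-strong (`SAWScalingLimit → NoTouchAt`)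

Definitions `MarkedConfig`, `NearRevisit`, `nearRevisitEvent`, `latticeCurve`, `IsSubseqLimit`,
`NoMarkedRevisitFor`, `NoTouchAt` are VERBATIM the reshaped skeleton's (same namespace), so the
theorem `stub_noMarkedRevisit` below has the registered signature and is a candidate `--supports`
landing for a prover (the drefuter may not land positive stub proofs).

* `isOpen_nearRevisitEvent` — the thickened event is open in `CurveClass ℂ` (sup-slack on the two
  compact parameter intervals + `Curve.exists_dist_reparam_lt`), and `nearRevisit_of_mk_mem`: THE
  POLYLINE of a lattice walk is in the configuration whenever its class is in the event;
* `measure_nearRevisitEvent_le` — portmanteau for open sets along `s n` (honest finite measures,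
  `finiteMeasure_le_liminf_measure_open_of_tendsto`), `liminf ≤ limsup`, `map s atTop ≤ 𝓝[>] 0`;
* `stub_noMarkedRevisit` — `S = (ℚ + iℚ) × ℝ × ℚ`; `N = ⋃_{rational (z, r, R), …} ⋂_k E_k` with the
  `θ_k = 1/(k+1)`-witnesses `(ε_k, R₁ᵏ, R₂ᵏ)` of `NoTouchAt` is `ν`-null; off `N` no representative
  has an exact marked revisit at any `p ∈ S` (embedding with a rational `r ∈ (ρ, min_{u ≤ lam} dist)`,
  exactly the lead's docstring plan);
* `noTouchAt_of_sawScalingLimit` — closed-enlargement portmanteau along `𝓝[>] 0` + compactness core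
  (a simple class in all `closure E_ε` would have `lam = T`, so `R₁ ≤ dist ≤ r`, contradicting
  `r < R₁`): the reshaped lattice input is implied by the summit conjunct.
-/

noncomputable section

open MeasureTheory Filter Topology Set Metric
open Literature.Probability.RandomPlanarGeometry Literature.Probability.LatticeModels
open scoped ENNReal NNReal BoundedContinuousFunction unitInterval

namespace Summit.CriticalPhenomena.SAWScalingLimit.Cruxes.SimpleSubseqLimits.MarkedPointRevisit

open Summit.CriticalPhenomena.SAWScalingLimit.Theorems.SimpleSubseqLimits.Negative
  (ae_carrier_of_isSLELaw)

/-! ## Vocabulary (verbatim from the reshaped skeleton) -/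

/-- verbatim -/
def MarkedConfig (γ : Curve ℂ) (z : ℂ) (ρ R : ℝ) (lam T : I) : Prop :=
  lam < T ∧ γ lam ∈ sphere z R ∧ (∀ u : I, lam ≤ u → u ≤ T → γ u ∈ closedBall z R) ∧
    γ T ∈ closedBall z ρ ∧ ∀ u : I, u < T → γ u ∉ closedBall z ρ

/-- verbatim -/
def NearRevisit (γ : Curve ℂ) (z : ℂ) (r R₁ R₂ ε : ℝ) : Prop :=
  ∃ lam T t' : I, lam < T ∧ T < t' ∧ R₁ < dist (γ lam) z ∧
    (∀ u : I, lam ≤ u → u ≤ T → dist (γ u) z < R₂) ∧ dist (γ T) z < r ∧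
    (∀ u : I, u ≤ lam → r < dist (γ u) z) ∧ dist (γ t') (γ lam) < ε

/-- verbatim -/
def nearRevisitEvent (z : ℂ) (r R₁ R₂ ε : ℝ) : Set (CurveClass ℂ) :=
  {c | ∃ γ : Curve ℂ, CurveClass.mk γ = c ∧ NearRevisit γ z r R₁ R₂ ε}

/-- verbatim -/
def latticeCurve {Ω : Set ℂ} {δ : ℝ} {u v : Site 2} (γ : SAW.DomainSAW Ω δ u v) : Curve ℂ :=
  ⟨γ.walk.toCurve (meshPoint δ)⟩

@[simp] theorem mk_latticeCurve {Ω : Set ℂ} {δ : ℝ} {u v : Site 2} (γ : SAW.DomainSAW Ω δ u v) :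
    CurveClass.mk (latticeCurve γ) = γ.curve := rfl

/-- verbatim -/
def IsSubseqLimit (D : DobrushinDomain) (a b : ℝ → Site 2) (s : ℕ → ℝ)
    (ν : Measure (CurveClass ℂ)) : Prop :=
  Tendsto s atTop (𝓝[>] (0 : ℝ)) ∧ IsProbabilityMeasure ν ∧
    ∀ f : CurveClass ℂ →ᵇ ℝ,
      Tendsto (fun n => ∫ γ, f γ.curve ∂(SAW.law D.carrier (s n) (a (s n)) (b (s n)))) atTop
        (𝓝 (∫ x, f x ∂ν))

/-- verbatim -/
def NoMarkedRevisitFor (ν : Measure (CurveClass ℂ)) : Prop :=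
  ∃ S : Set (ℂ × ℝ × ℝ), Dense S ∧
    ∀ᵐ c ∂ν, ∃ γ : Curve ℂ, CurveClass.mk γ = c ∧
      ∀ p ∈ S, ∀ lam T : I, MarkedConfig γ p.1 p.2.1 p.2.2 lam T →
        ∀ t' : I, T < t' → γ t' ≠ γ lam

/-- verbatim -/
def NoTouchAt (D : DobrushinDomain) (a b : ℝ → Site 2) : Prop :=
  ∀ (z : ℂ) (r R : ℝ), 0 < r → r < R → ∀ θ : ℝ≥0∞, 0 < θ →
    ∃ ε R₁ R₂ : ℝ, 0 < ε ∧ r < R₁ ∧ R₁ < R ∧ R < R₂ ∧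
      limsup (fun δ : ℝ => SAW.law D.carrier δ (a δ) (b δ)
          {γ | NearRevisit (latticeCurve γ) z r R₁ R₂ ε}) (𝓝[>] (0 : ℝ)) ≤ θ

/-! ## Embedding of exact marked configurations (the lead's docstring claim, checked) -/

/-- An exact `MarkedConfig γ z ρ R lam T` with an exact revisit `γ t' = γ lam`, `T < t'`, is a
`NearRevisit γ z r R₁ R₂ ε` whenever `ρ < r`, `r < dist (γ u) z` for all `u ≤ lam`, `R₁ < R < R₂`
and `0 < ε`. -/
theorem nearRevisit_of_markedConfig {γ : Curve ℂ} {z : ℂ} {ρ R r R₁ R₂ ε : ℝ} {lam T t' : I}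
    (h : MarkedConfig γ z ρ R lam T) (hTt : T < t') (hrev : γ t' = γ lam)
    (hρr : ρ < r) (hfar : ∀ u : I, u ≤ lam → r < dist (γ u) z) (hR₁ : R₁ < R) (hR₂ : R < R₂)
    (hε : 0 < ε) : NearRevisit γ z r R₁ R₂ ε := by
  obtain ⟨hlt, hsph, hin, hT, -⟩ := h
  refine ⟨lam, T, t', hlt, hTt, ?_, ?_, ?_, hfar, ?_⟩
  · rw [mem_sphere] at hsph; rw [hsph]; exact hR₁
  · intro u h1 h2
    have := hin u h1 h2
    rw [mem_closedBall] at this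
    exact this.trans_lt hR₂
  · rw [mem_closedBall] at hT; exact hT.trans_lt hρr
  · rw [hrev, dist_self]; exact hε

/-- In an exact marked configuration the past up to `lam` stays at distance `> ρ`, with a positive
margin: there is `m > ρ` (and `m ≤ R`) below all `dist (γ u) z`, `u ≤ lam`. -/
theorem exists_margin_of_markedConfig {γ : Curve ℂ} {z : ℂ} {ρ R : ℝ} {lam T : I}
    (h : MarkedConfig γ z ρ R lam T) :
    ∃ m : ℝ, ρ < m ∧ m ≤ R ∧ ∀ u : I, u ≤ lam → m ≤ dist (γ u) z := by
  obtain ⟨hlt, hsph, -, -, hfirst⟩ := h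
  have hgc : Continuous fun u : I => dist (γ u) z := γ.continuous.dist continuous_const
  obtain ⟨u₀, hu₀, hmin⟩ := (isCompact_Icc (a := (0 : I)) (b := lam)).exists_isMinOn
    ⟨0, le_rfl, unitInterval.nonneg'⟩ hgc.continuousOn
  refine ⟨dist (γ u₀) z, ?_, ?_, fun u hu => hmin ⟨unitInterval.nonneg', hu⟩⟩
  · have := hfirst u₀ (hu₀.2.trans_lt hlt)
    rwa [mem_closedBall, not_le] at this
  · have h1 : dist (γ u₀) z ≤ dist (γ lam) z := hmin ⟨unitInterval.nonneg', le_rfl⟩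
    rw [mem_sphere] at hsph
    rwa [hsph] at h1

/-! ## Invariance, sup-stability, openness -/

theorem nearRevisit_reparam {γ : Curve ℂ} {z : ℂ} {r R₁ R₂ ε : ℝ}
    (h : NearRevisit γ z r R₁ R₂ ε) (φ : I ≃o I) : NearRevisit (γ.reparam φ) z r R₁ R₂ ε := by
  obtain ⟨lam, T, t', hlt, hTt, hann, hin, hT, hfar, hd⟩ := h
  refine ⟨φ.symm lam, φ.symm T, φ.symm t', φ.symm.lt_iff_lt.2 hlt, φ.symm.lt_iff_lt.2 hTt,
    ?_, ?_, ?_, ?_, ?_⟩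
  · show R₁ < dist (γ (φ (φ.symm lam))) z; rw [φ.apply_symm_apply]; exact hann
  · intro u h1 h2
    show dist (γ (φ u)) z < R₂
    exact hin (φ u) (by simpa using φ.monotone h1) (by simpa using φ.monotone h2)
  · show dist (γ (φ (φ.symm T))) z < r; rw [φ.apply_symm_apply]; exact hT
  · intro u hu
    show r < dist (γ (φ u)) z
    exact hfar (φ u) (by simpa using φ.monotone hu)
  · show dist (γ (φ (φ.symm t'))) (γ (φ (φ.symm lam))) < ε
    rw [φ.apply_symm_apply, φ.apply_symm_apply]; exact hd

theorem nearRevisit_of_reparam {γ : Curve ℂ} {z : ℂ} {r R₁ R₂ ε : ℝ} (φ : I ≃o I)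
    (h : NearRevisit (γ.reparam φ) z r R₁ R₂ ε) : NearRevisit γ z r R₁ R₂ ε := by
  have h' := nearRevisit_reparam h φ.symm
  have heq : (γ.reparam φ).reparam φ.symm = γ := by
    apply Curve.ext; ext t
    show γ (φ (φ.symm t)) = γ t
    rw [φ.apply_symm_apply]
  rwa [heq] at h'

/-- **Sup-stability**: the configuration, with its witnesses, survives a uniformly small
perturbation. -/
theorem exists_forall_near {γ : Curve ℂ} {z : ℂ} {r R₁ R₂ ε : ℝ}
    (h : NearRevisit γ z r R₁ R₂ ε) :
    ∃ η : ℝ, 0 < η ∧ ∀ γ' : Curve ℂ, (∀ t, dist (γ t) (γ' t) < η) → NearRevisit γ' z r R₁ R₂ ε := by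
  obtain ⟨lam, T, t', hlt, hTt, hann, hin, hT, hfar, hd⟩ := h
  set g : I → ℝ := fun u => dist (γ u) z with hg
  have hgc : Continuous g := γ.continuous.dist continuous_const
  obtain ⟨u₀, hu₀, hmin⟩ := (isCompact_Icc (a := (0 : I)) (b := lam)).exists_isMinOn
    ⟨0, le_rfl, unitInterval.nonneg'⟩ hgc.continuousOn
  have hs₁ : 0 < g u₀ - r := sub_pos.2 (hfar u₀ hu₀.2)
  obtain ⟨u₁, hu₁, hmax⟩ := (isCompact_Icc (a := lam) (b := T)).exists_isMaxOn
    ⟨lam, le_rfl, hlt.le⟩ hgc.continuousOn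
  have hs₃ : 0 < R₂ - g u₁ := sub_pos.2 (hin u₁ hu₁.1 hu₁.2)
  have hs₂ : 0 < g lam - R₁ := sub_pos.2 hann
  have hs₄ : 0 < r - g T := sub_pos.2 hT
  have hs₅ : 0 < (ε - dist (γ t') (γ lam)) / 2 := by linarith
  set η : ℝ := min (min (min (g u₀ - r) (g lam - R₁)) (min (R₂ - g u₁) (r - g T)))
    ((ε - dist (γ t') (γ lam)) / 2) with hη
  have hηpos : 0 < η := lt_min (lt_min (lt_min hs₁ hs₂) (lt_min hs₃ hs₄)) hs₅
  have hη₁ : η ≤ g u₀ - r := (min_le_left _ _).trans ((min_le_left _ _).trans (min_le_left _ _))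
  have hη₂ : η ≤ g lam - R₁ := (min_le_left _ _).trans ((min_le_left _ _).trans (min_le_right _ _))
  have hη₃ : η ≤ R₂ - g u₁ := (min_le_left _ _).trans ((min_le_right _ _).trans (min_le_left _ _))
  have hη₄ : η ≤ r - g T := (min_le_left _ _).trans ((min_le_right _ _).trans (min_le_right _ _))
  have hη₅ : η ≤ (ε - dist (γ t') (γ lam)) / 2 := min_le_right _ _
  refine ⟨η, hηpos, fun γ' hγ' => ⟨lam, T, t', hlt, hTt, ?_, ?_, ?_, ?_, ?_⟩⟩
  · have h2 : dist (γ lam) z ≤ dist (γ lam) (γ' lam) + dist (γ' lam) z := dist_triangle _ _ _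
    have h3 := hγ' lam
    change η ≤ dist (γ lam) z - R₁ at hη₂
    linarith
  · intro u h1 h2
    have h4 : g u ≤ g u₁ := hmax ⟨h1, h2⟩
    have h5 : dist (γ' u) z ≤ dist (γ' u) (γ u) + dist (γ u) z := dist_triangle _ _ _
    have h6 := hγ' u
    rw [dist_comm] at h6
    change dist (γ u) z ≤ dist (γ u₁) z at h4
    change η ≤ R₂ - dist (γ u₁) z at hη₃
    linarith
  · have h5 : dist (γ' T) z ≤ dist (γ' T) (γ T) + dist (γ T) z := dist_triangle _ _ _
    have h6 := hγ' T
    rw [dist_comm] at h6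
    change η ≤ r - dist (γ T) z at hη₄
    linarith
  · intro u hu
    have h1 : g u₀ ≤ g u := hmin ⟨unitInterval.nonneg', hu⟩
    have h2 : dist (γ u) z ≤ dist (γ u) (γ' u) + dist (γ' u) z := dist_triangle _ _ _
    have h3 := hγ' u
    show r < dist (γ' u) z
    change dist (γ u₀) z ≤ dist (γ u) z at h1
    linarith
  · have h7 : dist (γ' t') (γ' lam) ≤
        dist (γ' t') (γ t') + dist (γ t') (γ lam) + dist (γ lam) (γ' lam) :=
      dist_triangle4 _ _ _ _
    have h8 := hγ' t'
    have h9 := hγ' lam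
    rw [dist_comm] at h8
    linarith

/-- **Openness** of the thickened event in `CurveClass ℂ` (claimed in the skeleton's docstring). -/
theorem isOpen_nearRevisitEvent (z : ℂ) (r R₁ R₂ ε : ℝ) : IsOpen (nearRevisitEvent z r R₁ R₂ ε) := by
  rw [Metric.isOpen_iff]
  rintro c ⟨γ, rfl, hγ⟩
  obtain ⟨η, hη, hstab⟩ := exists_forall_near hγ
  refine ⟨η, hη, fun c' hc' => ?_⟩
  obtain ⟨γ', rfl⟩ := CurveClass.surjective_mk c'
  rw [mem_ball] at hc'
  change dist (SeparationQuotient.mk γ') (SeparationQuotient.mk γ) < η at hc'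
  rw [SeparationQuotient.dist_mk, dist_comm] at hc'
  obtain ⟨φ, hφ⟩ := Curve.exists_dist_reparam_lt hc'
  have hnear : ∀ t, dist (γ t) (γ'.reparam φ t) < η := fun t =>
    (ContinuousMap.dist_apply_le_dist t).trans_lt hφ
  exact ⟨γ', rfl, nearRevisit_of_reparam φ (hstab _ hnear)⟩

/-- Every representative of a class in the event is in the configuration; in particular THE
POLYLINE of a lattice walk is whenever its class is. -/
theorem nearRevisit_of_mk_mem {γ : Curve ℂ} {z : ℂ} {r R₁ R₂ ε : ℝ}
    (h : CurveClass.mk γ ∈ nearRevisitEvent z r R₁ R₂ ε) : NearRevisit γ z r R₁ R₂ ε := by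
  obtain ⟨γ₀, h0, hγ₀⟩ := h
  obtain ⟨η, hη, hstab⟩ := exists_forall_near hγ₀
  have hd : dist γ₀ γ < η := by
    have : dist (CurveClass.mk γ₀) (CurveClass.mk γ) = 0 := by rw [h0, dist_self]
    change dist (SeparationQuotient.mk γ₀) (SeparationQuotient.mk γ) = 0 at this
    rw [SeparationQuotient.dist_mk] at this
    rw [this]; exact hη
  obtain ⟨φ, hφ⟩ := Curve.exists_dist_reparam_lt hd
  exact nearRevisit_of_reparam φ (hstab _ fun t => (ContinuousMap.dist_apply_le_dist t).trans_lt hφ)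

theorem nearRevisit_mono {γ : Curve ℂ} {z : ℂ} {r R₁ R₂ ε ε' : ℝ}
    (h : NearRevisit γ z r R₁ R₂ ε) (hε : ε ≤ ε') : NearRevisit γ z r R₁ R₂ ε' := by
  obtain ⟨lam, T, t', hlt, hTt, hann, hin, hT, hfar, hd⟩ := h
  exact ⟨lam, T, t', hlt, hTt, hann, hin, hT, hfar, hd.trans_le hε⟩

/-! ## Portmanteau bound for the open event along the sequence -/

/-- Under `IsSubseqLimit`, `ν (nearRevisitEvent …) ≤ limsup_{δ → 0⁺} P_δ[NearRevisit (polyline) …]`. -/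
theorem measure_nearRevisitEvent_le {D : DobrushinDomain} {a b : ℝ → Site 2} {s : ℕ → ℝ}
    {ν : Measure (CurveClass ℂ)} (hsub : IsSubseqLimit D a b s ν) (z : ℂ) (r R₁ R₂ ε : ℝ) :
    ν (nearRevisitEvent z r R₁ R₂ ε) ≤
      limsup (fun δ : ℝ => SAW.law D.carrier δ (a δ) (b δ)
        {γ | NearRevisit (latticeCurve γ) z r R₁ R₂ ε}) (𝓝[>] (0 : ℝ)) := by
  obtain ⟨hs, hν, hlim⟩ := hsub
  set G := nearRevisitEvent z r R₁ R₂ ε with hG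
  have hGo : IsOpen G := isOpen_nearRevisitEvent _ _ _ _ _
  let μs : ℕ → FiniteMeasure (CurveClass ℂ) := fun n =>
    ⟨(SAW.law D.carrier (s n) (a (s n)) (b (s n))).map (fun γ => γ.curve), inferInstance⟩
  let μ : FiniteMeasure (CurveClass ℂ) := ⟨ν, inferInstance⟩
  have hten : Tendsto μs atTop (𝓝 μ) := by
    rw [FiniteMeasure.tendsto_iff_forall_integral_tendsto]
    intro f
    refine (hlim f).congr fun n => ?_
    change _ = ∫ x, f x ∂((SAW.law D.carrier (s n) (a (s n)) (b (s n))).map (fun γ => γ.curve))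
    rw [integral_map (SAW.DomainSAW.measurable_of_top _).aemeasurable
      f.continuous.aestronglyMeasurable]
  have hport : (μ : Measure (CurveClass ℂ)) G ≤
      liminf (fun n => ((μs n : FiniteMeasure (CurveClass ℂ)) : Measure (CurveClass ℂ)) G) atTop :=
    Literature.Probability.Percolation.QuadCrossing.finiteMeasure_le_liminf_measure_open_of_tendsto
      hten hGo
  set f : ℝ → ℝ≥0∞ := fun δ => SAW.law D.carrier δ (a δ) (b δ)
    {γ | NearRevisit (latticeCurve γ) z r R₁ R₂ ε} with hf
  have hle : ∀ n, ((μs n : FiniteMeasure (CurveClass ℂ)) : Measure (CurveClass ℂ)) G ≤ f (s n) := by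
    intro n
    change ((SAW.law D.carrier (s n) (a (s n)) (b (s n))).map (fun γ => γ.curve)) G ≤ _
    rw [Measure.map_apply (SAW.DomainSAW.measurable_of_top _) hGo.measurableSet]
    refine measure_mono fun γ hγ => ?_
    have hγ' : CurveClass.mk (latticeCurve γ) ∈ G := by rw [mk_latticeCurve]; exact hγ
    exact nearRevisit_of_mk_mem hγ'
  calc ν G = (μ : Measure (CurveClass ℂ)) G := rfl
    _ ≤ liminf (fun n => ((μs n : FiniteMeasure (CurveClass ℂ)) : Measure (CurveClass ℂ)) G)
          atTop := hport
    _ ≤ limsup (fun n => ((μs n : FiniteMeasure (CurveClass ℂ)) : Measure (CurveClass ℂ)) G)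
          atTop := liminf_le_limsup
    _ ≤ limsup (fun n => f (s n)) atTop := limsup_le_limsup (Eventually.of_forall hle)
    _ = limsup f (map s atTop) := Filter.limsup_comp f s atTop
    _ ≤ limsup f (𝓝[>] (0 : ℝ)) := limsup_le_limsup_of_le hs

/-! ## Stub 4 (lead's reshape), PROVED -/

/-- Rational complex numbers. -/
def ratPt (q : ℚ × ℚ) : ℂ := (q.1 : ℂ) + (q.2 : ℂ) * Complex.I

theorem denseRange_ratPt : DenseRange ratPt := by
  have h1 : DenseRange (Prod.map ((↑) : ℚ → ℝ) ((↑) : ℚ → ℝ)) :=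
    Rat.denseRange_cast.prodMap Rat.denseRange_cast
  have h2 : DenseRange (fun p : ℝ × ℝ => Complex.equivRealProdCLM.symm p) :=
    Complex.equivRealProdCLM.symm.surjective.denseRange
  have h3 := h2.comp h1 Complex.equivRealProdCLM.symm.continuous
  convert h3 using 1
  ext q
  simp [ratPt, Complex.equivRealProdCLM_symm_apply]

/-- The parameter set of the lead's plan: rational centres, arbitrary `ρ`, rational `R` (dense). -/
def ratParams : Set (ℂ × ℝ × ℝ) :=
  (Set.range ratPt) ×ˢ ((Set.univ : Set ℝ) ×ˢ Set.range ((↑) : ℚ → ℝ))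

theorem dense_ratParams : Dense ratParams :=
  denseRange_ratPt.prod (dense_univ.prod Rat.denseRange_cast)

/-- The bad set at rational parameters `(z, r, R)`: classes lying in EVERY thickened event
`nearRevisitEvent z r R₁ R₂ ε`, `ε > 0`, `r < R₁ < R < R₂`. It is `ν`-null under `NoTouchAt`. -/
def badSet (z : ℂ) (r R : ℝ) : Set (CurveClass ℂ) :=
  {c | ∀ ε R₁ R₂ : ℝ, 0 < ε → r < R₁ → R₁ < R → R < R₂ → c ∈ nearRevisitEvent z r R₁ R₂ ε}

theorem measure_badSet_eq_zero {D : DobrushinDomain} {a b : ℝ → Site 2} {s : ℕ → ℝ}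
    {ν : Measure (CurveClass ℂ)} (hNT : NoTouchAt D a b) (hsub : IsSubseqLimit D a b s ν)
    {z : ℂ} {r R : ℝ} (hr : 0 < r) (hrR : r < R) : ν (badSet z r R) = 0 := by
  refine le_antisymm (le_of_forall_gt_imp_ge_of_dense fun θ hθ => ?_) bot_le
  obtain ⟨ε, R₁, R₂, hε, h₁, h₂, h₃, hbound⟩ := hNT z r R hr hrR θ hθ
  calc ν (badSet z r R) ≤ ν (nearRevisitEvent z r R₁ R₂ ε) :=
        measure_mono fun c hc => hc ε R₁ R₂ hε h₁ h₂ h₃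
    _ ≤ _ := measure_nearRevisitEvent_le hsub z r R₁ R₂ ε
    _ ≤ θ := hbound

/-- **Stub 4 (reshaped), exact registered signature — PROVED.** -/
theorem stub_noMarkedRevisit :
    ∀ (D : DobrushinDomain) (a b : ℝ → Site 2) (s : ℕ → ℝ) (ν : Measure (CurveClass ℂ)),
      NoTouchAt D a b → IsSubseqLimit D a b s ν → NoMarkedRevisitFor ν := by
  intro D a b s ν hNT hsub
  haveI := hsub.2.1
  refine ⟨ratParams, dense_ratParams, ?_⟩
  -- the countable family of null sets
  set Z : (ℚ × ℚ) → ℚ → ℚ → Set (CurveClass ℂ) := fun q r R =>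
    {c | (0 : ℝ) < r ∧ (r : ℝ) < R ∧ c ∈ badSet (ratPt q) r R} with hZ
  have hZnull : ∀ q r R, ν (Z q r R) = 0 := by
    intro q r R
    by_cases h : (0 : ℝ) < r ∧ (r : ℝ) < R
    · refine measure_mono_null (fun c hc => hc.2.2) (measure_badSet_eq_zero hNT hsub h.1 h.2)
    · have : Z q r R = ∅ := by
        ext c
        simp only [hZ, mem_setOf_eq, mem_empty_iff_false, iff_false, not_and]
        exact fun h1 h2 => absurd ⟨h1, h2⟩ h
      rw [this, measure_empty]
  set N : Set (CurveClass ℂ) := ⋃ q, ⋃ r, ⋃ R, Z q r R with hN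
  have hNnull : ν N = 0 := by
    simp only [hN, measure_iUnion_null_iff]
    exact fun q r R => hZnull q r R
  filter_upwards [measure_eq_zero_iff_ae_notMem.1 hNnull] with c hc
  obtain ⟨γ, rfl⟩ := CurveClass.surjective_mk c
  refine ⟨γ, rfl, ?_⟩
  rintro ⟨z, ρ, R⟩ ⟨⟨q, hq⟩, -, ⟨R', hR'⟩⟩ lam T hmk t' hTt heq
  simp only at hq hR' hmk
  subst hq; subst hR'
  apply hc
  -- a rational approach radius strictly between `ρ` and the past's margin
  obtain ⟨m, hρm, hmR, hmle⟩ := exists_margin_of_markedConfig hmk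
  obtain ⟨r, hρr, hrm⟩ := exists_rat_btwn hρm
  have hρ0 : 0 ≤ ρ := by
    have hT := hmk.2.2.2.1
    rw [mem_closedBall] at hT
    exact dist_nonneg.trans hT
  have hr0 : (0 : ℝ) < r := hρ0.trans_lt hρr
  have hrR : (r : ℝ) < R' := hrm.trans_le hmR
  refine mem_iUnion.2 ⟨q, mem_iUnion.2 ⟨r, mem_iUnion.2 ⟨R', hr0, hrR, ?_⟩⟩⟩
  intro ε R₁ R₂ hε _ h₂ h₃
  exact ⟨γ, rfl, nearRevisit_of_markedConfig hmk hTt heq hρr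
    (fun u hu => hrm.trans_le (hmle u hu)) h₂ h₃ hε⟩

/-! ## Stub 5's target is implied by the summit conjunct -/

/-- A simple class lies in the closures of the thickened events for all `ε = 1/(n+1)` only if
`R₁ ≤ r`. -/
theorem not_mem_closure_nearRevisitEvent_forall_of_simple {z : ℂ} {r R₁ R₂ : ℝ}
    (h₁ : r < R₁) {c : CurveClass ℂ} (hc : c ∈ CurveClass.simple)
    (h : ∀ n : ℕ, c ∈ closure (nearRevisitEvent z r R₁ R₂ (1 / ((n : ℝ) + 1)))) : False := by
  obtain ⟨η, hη, rfl⟩ := hc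
  have hex : ∀ n : ℕ, ∃ γ : Curve ℂ, NearRevisit γ z r R₁ R₂ (1 / ((n : ℝ) + 1)) ∧
      ∀ t, dist (η t) (γ t) < 1 / ((n : ℝ) + 1) := by
    intro n
    obtain ⟨b, hb, hd⟩ := Metric.mem_closure_iff.1 (h n) _ (by positivity : (0 : ℝ) < 1 / ((n : ℝ) + 1))
    obtain ⟨γ, rfl, hγ⟩ := hb
    change dist (SeparationQuotient.mk η) (SeparationQuotient.mk γ) < _ at hd
    rw [SeparationQuotient.dist_mk] at hd
    obtain ⟨φ, hφ⟩ := Curve.exists_dist_reparam_lt hd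
    exact ⟨γ.reparam φ, nearRevisit_reparam hγ φ,
      fun t => (ContinuousMap.dist_apply_le_dist t).trans_lt hφ⟩
  choose γ hγ hclose using hex
  choose lam T t' hlt hTt hann hin hT hfar hdist using hγ
  obtain ⟨⟨lam₀, T₀, t₀⟩, ψ, hψ, hlim⟩ :=
    CompactSpace.tendsto_subseq (fun n => (lam n, T n, t' n))
  have hlam : Tendsto (fun k => lam (ψ k)) atTop (𝓝 lam₀) :=
    (continuous_fst.tendsto _).comp hlim
  have hTl : Tendsto (fun k => T (ψ k)) atTop (𝓝 T₀) :=
    (continuous_fst.comp continuous_snd).tendsto _ |>.comp hlim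
  have htl : Tendsto (fun k => t' (ψ k)) atTop (𝓝 t₀) :=
    (continuous_snd.comp continuous_snd).tendsto _ |>.comp hlim
  have herr : Tendsto (fun k : ℕ => 1 / ((ψ k : ℝ) + 1)) atTop (𝓝 0) := by
    have h1 : Tendsto (fun k : ℕ => 1 / ((k : ℝ) + 1)) atTop (𝓝 0) :=
      tendsto_one_div_add_atTop_nhds_zero_nat
    refine squeeze_zero (fun k => by positivity) (fun k => ?_) h1
    have : (k : ℝ) ≤ ψ k := by exact_mod_cast hψ.id_le k
    exact one_div_le_one_div_of_le (by positivity) (by linarith)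
  have hval : ∀ {u : ℕ → I} {u₀ : I}, Tendsto (fun k => u (ψ k)) atTop (𝓝 u₀) →
      Tendsto (fun k => γ (ψ k) (u (ψ k))) atTop (𝓝 (η u₀)) := by
    intro u u₀ hu
    rw [tendsto_iff_dist_tendsto_zero]
    have h2 : Tendsto (fun k => dist (η (u (ψ k))) (η u₀)) atTop (𝓝 0) := by
      rw [← tendsto_iff_dist_tendsto_zero]
      exact (η.continuous.tendsto u₀).comp hu
    refine squeeze_zero (fun k => dist_nonneg) (fun k => ?_)
      (by simpa only [add_zero] using herr.add h2)
    calc dist (γ (ψ k) (u (ψ k))) (η u₀)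
        ≤ dist (γ (ψ k) (u (ψ k))) (η (u (ψ k))) + dist (η (u (ψ k))) (η u₀) := dist_triangle _ _ _
      _ ≤ 1 / ((ψ k : ℝ) + 1) + dist (η (u (ψ k))) (η u₀) := by
          gcongr; rw [dist_comm]; exact (hclose (ψ k) _).le
  have hvlam := hval hlam
  have hvT := hval hTl
  have hvt := hval htl
  have ha : R₁ ≤ dist (η lam₀) z :=
    ge_of_tendsto' (hvlam.dist tendsto_const_nhds) fun k => (hann (ψ k)).le
  have hb : dist (η T₀) z ≤ r :=
    le_of_tendsto' (hvT.dist tendsto_const_nhds) fun k => (hT (ψ k)).le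
  have hc' : η t₀ = η lam₀ := by
    have hh1 : Tendsto (fun k => dist (γ (ψ k) (t' (ψ k))) (γ (ψ k) (lam (ψ k)))) atTop
        (𝓝 (dist (η t₀) (η lam₀))) := hvt.dist hvlam
    have hh2 : Tendsto (fun k => dist (γ (ψ k) (t' (ψ k))) (γ (ψ k) (lam (ψ k)))) atTop (𝓝 0) :=
      squeeze_zero (fun k => dist_nonneg) (fun k => (hdist (ψ k)).le) herr
    exact dist_eq_zero.1 (tendsto_nhds_unique hh1 hh2)
  have hd1 : lam₀ ≤ T₀ := le_of_tendsto_of_tendsto' hlam hTl fun k => (hlt (ψ k)).le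
  have hd2 : T₀ ≤ t₀ := le_of_tendsto_of_tendsto' hTl htl fun k => (hTt (ψ k)).le
  have he : t₀ = lam₀ := hη hc'
  have hTeq : T₀ = lam₀ := le_antisymm (he ▸ hd2) hd1
  rw [hTeq] at hb
  linarith

/-- **The reshaped lattice input is implied by the summit conjunct**: under `SAWScalingLimit`,
`NoTouchAt D a b` holds along every endpoint approximation (any `R₁ ∈ (r, R)`, `R₂ > R` work). -/
theorem noTouchAt_of_sawScalingLimit (hS : _root_.SAWScalingLimit) {D : DobrushinDomain}
    {a b : ℝ → Site 2} (hab : SAW.IsEndpointApprox D a b) : NoTouchAt D a b := by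
  intro z r R hr hrR θ hθ
  obtain ⟨Γ, hΓ, -, hT⟩ := hS D a b hab
  haveI : Fact Literature.Probability.Process.isProjectiveLimit_preWienerMeasure :=
    ⟨isProjectiveLimit_preWienerMeasure_holds⟩
  set μ : Measure (CurveClass ℂ) := Literature.Probability.Process.preWienerMeasure.map Γ with hμdef
  have hμ : IsSLELaw ((8 : ℝ≥0) / 3) D μ := ⟨Γ, hΓ, rfl⟩
  haveI := hμ.isProbabilityMeasure
  -- radii: `R₁` midway between `r` and `R`, `R₂ = R + 1`
  set R₁ : ℝ := (r + R) / 2 with hR₁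
  set R₂ : ℝ := R + 1 with hR₂
  have h₁ : r < R₁ := by rw [hR₁]; linarith
  have h₂ : R₁ < R := by rw [hR₁]; linarith
  have h₃ : R < R₂ := by rw [hR₂]; linarith
  -- closed enlargements and their vanishing mass
  set F : ℕ → Set (CurveClass ℂ) := fun n =>
    closure (nearRevisitEvent z r R₁ R₂ (1 / ((n : ℝ) + 1))) with hF
  have hanti : Antitone F := by
    intro m n hmn
    have hmn' : (m : ℝ) ≤ n := by exact_mod_cast hmn
    refine closure_mono ?_
    rintro c ⟨γ, rfl, hγ⟩
    exact ⟨γ, rfl, nearRevisit_mono hγ (one_div_le_one_div_of_le (by positivity) (by linarith))⟩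
  have hlimF := tendsto_measure_iInter_atTop (μ := μ)
    (fun n : ℕ => (isClosed_closure : IsClosed (F n)).measurableSet.nullMeasurableSet)
    hanti ⟨0, measure_ne_top μ _⟩
  have h0 : μ (⋂ n : ℕ, F n) = 0 := by
    have hae := ae_carrier_of_isSLELaw hμ
    rw [ae_iff] at hae
    refine measure_mono_null (fun c hc => ?_) hae
    intro hcar
    exact not_mem_closure_nearRevisitEvent_forall_of_simple h₁ hcar.1 (mem_iInter.1 hc)
  rw [h0] at hlimF
  obtain ⟨n, hn⟩ := ((tendsto_order.1 hlimF).2 θ hθ).exists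
  refine ⟨1 / ((n : ℝ) + 1), R₁, R₂, by positivity, h₁, h₂, h₃, ?_⟩
  have hFc : IsClosed (F n) := isClosed_closure
  let μs : ℝ → FiniteMeasure (CurveClass ℂ) := fun δ =>
    ⟨(SAW.law D.carrier δ (a δ) (b δ)).map (fun γ => γ.curve), inferInstance⟩
  let μf : FiniteMeasure (CurveClass ℂ) := ⟨μ, inferInstance⟩
  have hlim : Tendsto μs (𝓝[>] (0 : ℝ)) (𝓝 μf) := by
    rw [FiniteMeasure.tendsto_iff_forall_integral_tendsto]
    intro f
    have hh := hT f
    rw [← integral_map hΓ.aemeasurable f.continuous.aestronglyMeasurable] at hh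
    refine hh.congr fun δ => ?_
    change _ = ∫ x, f x ∂((SAW.law D.carrier δ (a δ) (b δ)).map (fun γ => γ.curve))
    rw [integral_map (SAW.DomainSAW.measurable_of_top _).aemeasurable
      f.continuous.aestronglyMeasurable]
  have hport := FiniteMeasure.limsup_measure_closed_le_of_tendsto hlim hFc
  have hle : ∀ δ : ℝ, SAW.law D.carrier δ (a δ) (b δ)
      {γ | NearRevisit (latticeCurve γ) z r R₁ R₂ (1 / ((n : ℝ) + 1))} ≤
        ((μs δ : FiniteMeasure (CurveClass ℂ)) : Measure (CurveClass ℂ)) (F n) := by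
    intro δ
    change _ ≤ ((SAW.law D.carrier δ (a δ) (b δ)).map (fun γ => γ.curve)) (F n)
    rw [Measure.map_apply (SAW.DomainSAW.measurable_of_top _) hFc.measurableSet]
    refine measure_mono fun γ hγ => ?_
    show γ.curve ∈ F n
    rw [← mk_latticeCurve]
    exact subset_closure ⟨latticeCurve γ, rfl, hγ⟩
  calc limsup (fun δ : ℝ => SAW.law D.carrier δ (a δ) (b δ)
          {γ | NearRevisit (latticeCurve γ) z r R₁ R₂ (1 / ((n : ℝ) + 1))}) (𝓝[>] (0 : ℝ))
      ≤ limsup (fun δ => ((μs δ : FiniteMeasure (CurveClass ℂ)) : Measure (CurveClass ℂ)) (F n))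
          (𝓝[>] (0 : ℝ)) := limsup_le_limsup (Eventually.of_forall hle)
    _ ≤ (μf : Measure (CurveClass ℂ)) (F n) := hport
    _ ≤ θ := hn.le

/-- Hence the reshaped STUB 5 statement follows from the summit conjunct (not over-strong). -/
theorem stub_onePointNoTouch_of_sawScalingLimit (hS : _root_.SAWScalingLimit) :
    ∀ (D : DobrushinDomain) (a b : ℝ → Site 2), SAW.IsEndpointApprox D a b → NoTouchAt D a b :=
  fun _ _ _ hab => noTouchAt_of_sawScalingLimit hS hab

end Summit.CriticalPhenomena.SAWScalingLimit.Cruxes.SimpleSubseqLimits.MarkedPointRevisit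

end
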